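import Summits.NavierStokesRegularity.FunctionalMining.TopEigStrainMixLawTwo
import HarnessLib

/-!
# FunctionalMining/NoGo — D-K6 (a) at the row `q = 2`: the rate exponent of the mixtures
# `F_ε = Φ₂ + ε ℰ` is at most `γ(2) = 3` (not `5`)

Search for candidate a priori estimates; no regularity claim. Cell `pub-nsfunc`, no-go seat (gen 35),
STAGED for the prove seat (the planner seat cannot file under `FunctionalMining/`; see
`pub-nsfunc-nogo/NoGo/STAGING.md`). The `q = 2` companion of the no-go seat's K3
(`NoGo/TopEigStrainMixRateGamma`, real `q > 2`, rate exponent `≤ γ = (3q−3)/(2q−3)`). Imports ONLY the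
prove seat's tree file `TopEigStrainMixLawTwo` (p352312; BY NAME: `continuousWithinAt_topEigStrainMix_two`)
and, through it, `TopEigMixProductionTwo` (p351988; `TopEig.eulerProduction_two_le`, the Euler production
of `Φ₂` through the enstrophy chain) and `TopEigStrainMixDeriv` (fence tools `hasDerivWithinAt_le_of_fence`,
`sub_le_mul_of_deriv_right_le` — used BY NAME).

MECHANISM. The prove seat's `TopEigStrainMixLawTwo` (`topEigStrainMixRate_two :
TopEigStrainMixRate 2 5`) bounds the right derivative of `F_ε(u(s)) = Φ₂ + ε Z₂` (`Z₂ = ℰ`,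
`torusStrainMoment_two`) by `(C₀(1+ε))⁴ (εν)^{−3} E³` (`E = ‖∇u‖₂² = 2ℰ`; Young with weight `εν`
against the absorbing dissipation `εν‖Δu‖₂²`) and then spends `ε^{−2}` on `E³ ≤ 4 ε^{−2} E F_ε²`
(`F_ε ≥ ε ℰ`), whence its exponent `5 = γ + 1 + 1/σ` at `q = 2`. That last step is free of charge: by
the COERCIVITY of the top eigenvalue on trace-free symmetric tensors (`|S| ≤ 6 λ₁`, tree
`TopEig.norm_strainFlat_le`) `ℰ = ∫|S|² ≤ 36 ∫(λ₁⁺)² = 36 Φ₂ ≤ 36 F_ε` for EVERY `ε ≥ 0`, so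
`E³ = E·E² ≤ 5184 E F_ε²` uniformly in `ε` and the only `ε`-price left is the Young weight
`(εν)^{−3}`: `κ(ε) = 5184 (C₀(1+ε))⁴ ε^{−3}`, rate exponent `3 = γ(2) = (3q−3)/(2q−3)` at `q = 2`
— the value the `q > 2` theorem `topEigStrainMixRate_gamma_of_two_lt` (K3) would give at `q = 2`,
where its strain-moment chain does not apply. The observation at `q = 2` was made on paper, the same
hour, by census-1 (PEN REMARK (cc.117), INBOX l.4412: `ℰ = Z₂ ≤ 6Φ₂ ≤ 6F_ε`, sharp constant; the tree
lemma gives `36`) and by census-2 ((dd.184), l.4415: K3's coercivity step verbatim at `q = 2`); this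
file is their kernel-checked form, written as the prove seat's §1 proof verbatim (acknowledged) with the one
step changed, exactly as K3 was for `q > 2`.

CONTENT (`T³ = UnitAddTorus (Fin 3)`):
* `TopEig.torusEnstrophy_le_topEigMoment_two` — `ℰ ≤ 36 Φ₂` for smooth divergence-free fields, and
  `TopEig.torusEnstrophy_le_topEigStrainMix_two` — `ℰ ≤ 36 F_ε` (`ε ≥ 0`);
* **`TopEig.exists_topEigStrainMix_two_rightDeriv_le_gamma`** — the right derivative of `F_ε(u(s))`
  at every `t ∈ [a, b)` is `≤ 5184 (C₀(1+ε))⁴ ε^{−3} ν^{−3} (2ℰ) F_ε²`, ONE `C₀ ≥ 0` for all `ε > 0`,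
  `ν > 0` and all unforced classical solutions;
* `TopEig.exists_topEigStrainMix_two_rate_le_gamma` — the same bound for every one-sided derivative
  value within the window (Dini fencing, as in the prove seat's part 2);
* **`TopEig.topEigStrainMixRate_two_gamma`** — `TopEigStrainMixRate 2 3`: the dictionary number of
  escape (a) at `q = 2` satisfies `a* ≤ 3 = γ(2)` (the dict seat's node `TopEigStrainMixRateGamma 2`);
  `TopEig.topEigStrainMixRate_two_of_three_le` — every exponent `a ≥ 3` (in particular the prove
  seat's `5`, tree `topEigStrainMixRate_two`) by monotonicity.

NOT claimed: the law node `TopEigStrainMixLaw 2 ε` for every `ε > 0` is the prove seat's tree theorem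
`topEigStrainMixLaw_two` and is not restated here (for small `ε` it also follows from the rate by
`TopEigStrainMixRate.law_of_le`); nothing at `ε = 0` (refuted: `NoGo/TopEigSaturatingKill`), nothing
for `3/2 < q < 2`, no lower bound on the exponent (the floor of record is logarithmic,
`NoGo/TopEigStrainMixLogRate` staged), and nothing about Navier–Stokes regularity. [ours]
FILING (prove seat g25, REQUEST #18): declarations byte-identical to the no-go seat's staged `TopEigStrainMixRateGammaTwo.STAGING.lean` e21f40583da310d6; this line is the only addition.
-/

noncomputable section

open MeasureTheory Set Filter Topology Finset
open scoped InnerProductSpace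

namespace Summit.NavierStokesRegularity.FunctionalMining

open Literature.Analysis.FunctionSpaces Literature.Analysis.FluidPDE

namespace TopEig

open StrainL4 StrainMoment VorticityL4 StrainTensor Torus

/-! ## 1. Coercivity at `q = 2`: `ℰ ≤ 36 Φ₂ ≤ 36 F_ε` -/

/-- **`ℰ ≤ 36 Φ₂` on `T³`:** `∫|S|² ≤ 36 ∫(λ₁⁺)²` for smooth divergence-free `v` (pointwise
`|S| ≤ 6 λ₁`, `TopEig.norm_strainFlat_le`; `∫|S|² = ℰ`, `torusStrainMoment_two`). [ours, bookkeeping] -/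
theorem torusEnstrophy_le_topEigMoment_two {v : UnitAddTorus (Fin 3) → EuclideanSpace ℝ (Fin 3)}
    (hv : Torus.IsSmooth v) (hdiv : Torus.IsDivFree v) :
    torusEnstrophy v ≤ 36 * torusTopEigMoment 2 v := by
  rw [← torusStrainMoment_two hv hdiv, torusStrainMoment_eq_integral_norm, torusTopEigMoment_eq hv hdiv 2,
    ← integral_const_mul]
  have hρc : Continuous fun x => lam (strainFlat v x) := continuous_lam.comp (continuous_strainFlat hv)
  refine integral_mono_of_nonneg (ae_of_all _ fun x => Real.rpow_nonneg (norm_nonneg _) _)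
    (((hρc.rpow_const fun x => Or.inr (by norm_num)).const_mul _).integrable_unitAddTorus)
    (ae_of_all _ fun x => ?_)
  show ‖strainFlat v x‖ ^ (2 : ℝ) ≤ 36 * lam (strainFlat v x) ^ (2 : ℝ)
  have h36 : (36 : ℝ) = (6 : ℝ) ^ (2 : ℝ) := by norm_num
  rw [h36, ← Real.mul_rpow (by norm_num) (lam_strainFlat_nonneg hv hdiv x)]
  exact Real.rpow_le_rpow (norm_nonneg _) (norm_strainFlat_le hv hdiv x) (by norm_num)

/-- **`ℰ ≤ 36 F_ε` on `T³`** at `q = 2`, for every `ε ≥ 0` (`Φ₂ ≤ F_ε`). [ours, bookkeeping] -/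
theorem torusEnstrophy_le_topEigStrainMix_two {ε : ℝ} (hε : 0 ≤ ε)
    {v : UnitAddTorus (Fin 3) → EuclideanSpace ℝ (Fin 3)} (hv : Torus.IsSmooth v)
    (hdiv : Torus.IsDivFree v) : torusEnstrophy v ≤ 36 * topEigStrainMix 2 ε v := by
  have h1 := torusEnstrophy_le_topEigMoment_two hv hdiv
  have h2 : torusTopEigMoment 2 v ≤ topEigStrainMix 2 ε v := by
    have := mul_nonneg hε (torusStrainMoment_nonneg 2 v)
    unfold topEigStrainMix; linarith
  linarith

/-! ## 2. The right derivative of `F_ε(u(s))` with the `ε^{−3}` budget -/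

/-- **The right derivative of `F_ε = Φ₂ + ε Z₂` along Navier–Stokes, `ε^{−3}` budget (`q = 2`).**
There is `C₀ ≥ 0` such that for every `ε > 0`, every `ν > 0` and every classical solution of unforced
Navier–Stokes on `T³ × [a, b]`, at every `t ∈ [a, b)`: `s ↦ F_ε(u(s))` has a right derivative `R`
within `[t, ∞)` with `R ≤ 5184 (C₀(1+ε))⁴ ε^{−3} ν^{−3} (2ℰ(u t)) F_ε(u t)²`. The prove seat's
`exists_topEigStrainMix_two_rightDeriv_le` (tree `TopEigStrainMixLawTwo`) verbatim, with its step
`E³ ≤ 4 ε^{−2} E F_ε²` replaced by `E³ ≤ 5184 E F_ε²` (`ℰ ≤ 36 F_ε`). [ours] -/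
theorem exists_topEigStrainMix_two_rightDeriv_le_gamma :
    ∃ C₀ : ℝ, 0 ≤ C₀ ∧ ∀ {ε : ℝ}, 0 < ε → ∀ {ν a b : ℝ}, 0 < ν → a < b →
      ∀ {u : ℝ → UnitAddTorus (Fin 3) → EuclideanSpace ℝ (Fin 3)} {p : ℝ → UnitAddTorus (Fin 3) → ℝ},
      Torus.IsClassicalNSSolutionOn (Icc a b) ν 0 u p → ∀ {t : ℝ}, t ∈ Ico a b →
      ∃ R : ℝ, HasDerivWithinAt (fun s => topEigStrainMix 2 ε (u s)) R (Ici t) t ∧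
        R ≤ 5184 * (C₀ * (1 + ε)) ^ (4 : ℝ) * ε ^ (-(3 : ℝ)) * ν ^ (-(3 : ℝ)) *
          ((2 * torusEnstrophy (u t)) * topEigStrainMix 2 ε (u t) ^ 2) := by
  obtain ⟨K₁, hK₁⟩ := Torus.integral_sum_norm_sq_partialDeriv_sq_le (d := Fin 3) (by simp)
  obtain ⟨CP, hCP0, hCP⟩ := exists_hess_rpow (d := Fin 3) (q := 2) (by norm_num)
  obtain ⟨K₂, hK₂⟩ := Torus.abs_integral_inner_convect_laplacian_le (d := Fin 3) (by simp)
  have hK₁0 : (0 : ℝ) ≤ K₁ := NNReal.coe_nonneg K₁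
  have hK₂0 : (0 : ℝ) ≤ K₂ := NNReal.coe_nonneg K₂
  obtain ⟨C₁, hC₁⟩ : ∃ C : ℝ, C = 2 * (2 * (81 * CP + 1) * K₁) ^ (1 / 2 : ℝ) := ⟨_, rfl⟩
  have hC₁0 : 0 ≤ C₁ := by rw [hC₁]; positivity
  refine ⟨C₁ + K₂, add_nonneg hC₁0 hK₂0, ?_⟩
  intro ε hε ν a b hν hab u p hsol t ht
  have ht' : t ∈ Icc a b := ⟨ht.1, ht.2.le⟩
  have h12 : (1 : ℝ) ≤ 2 := by norm_num
  have hut : IsSmooth (u t) := hsol.smooth_velocity.isSmooth_slice ht'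
  have hdiv : IsDivFree (u t) := hsol.divFree t ht'
  obtain ⟨E, hE⟩ : ∃ E : ℝ, E = gradNormSq (u t) := ⟨_, rfl⟩
  obtain ⟨L, hL⟩ : ∃ L : ℝ, L = ∫ x, ‖Torus.laplacian (u t) x‖ ^ 2 := ⟨_, rfl⟩
  have hE0 : 0 ≤ E := by rw [hE]; exact gradNormSq_nonneg _
  have hL0 : 0 ≤ L := by rw [hL]; exact integral_nonneg fun x => sq_nonneg _
  have hEns : torusEnstrophy (u t) = 2⁻¹ * E := by rw [hE]; rfl
  -- the right derivative of `Φ₂`, transport-free, with the heat sieve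
  obtain ⟨RΦ, hRΦ, hRΦle, -⟩ :=
    hasDerivWithinAt_topEigMoment_le_heat_add_production hν.le hsol hab h12 ht
  have hT0 : 0 ≤ heatDissipation (torusTopEigMoment 2) (u t) :=
    heatDissipation_nonneg_of_admissible h12 convexOn_lam lipschitzWith_lam
      (fun _ hv hdv x => lam_strainFlat_nonneg hv hdv x)
      (fun _ hv hdv => torusTopEigMoment_eq hv hdv 2) hut hdiv
  have hNPeq : ∫ x, 2 * torusStrainTopEig (u t) x ^ ((2 : ℝ) - 1) * dirTopEig (strainFlat (u t) x)
      (-pressVec (p t) x + strainFlat ((0 : ℝ → UnitAddTorus (Fin 3) → EuclideanSpace ℝ (Fin 3)) t) x -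
        nonlinVec (u t) x) = ∫ x, 2 * torusStrainTopEig (u t) x ^ ((2 : ℝ) - 1) *
      dirTopEig (strainFlat (u t) x) (-pressVec (p t) x - nonlinVec (u t) x) :=
    integral_congr_ae (ae_of_all _ fun x => by simp only [Pi.zero_apply, strainFlat_zero, add_zero])
  have hNP := eulerProduction_two_le hK₁0 hCP0 hK₁ hsol (fun s hs i j => hCP hab hsol s hs i j) ht'
  rw [← hE, ← hL, ← hC₁] at hNP
  have hRΦ' : RΦ ≤ C₁ * E ^ (3 / 4 : ℝ) * L ^ (3 / 4 : ℝ) := by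
    rw [hNPeq] at hRΦle
    have hneg : -(ν * heatDissipation (torusTopEigMoment 2) (u t)) ≤ 0 := by
      have := mul_nonneg hν.le hT0; linarith
    calc RΦ ≤ _ := hRΦle
      _ ≤ 0 + C₁ * E ^ (3 / 4 : ℝ) * L ^ (3 / 4 : ℝ) := add_le_add hneg hNP
      _ = _ := zero_add _
  -- the enstrophy derivative within the window, moved to `[t, ∞)`
  obtain ⟨X, hX⟩ : ∃ X : ℝ, X = ∫ x, ⟪Torus.convect (u t) (u t) x, Torus.laplacian (u t) x⟫_ℝ :=
    ⟨_, rfl⟩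
  have hXle : X ≤ K₂ * E ^ (3 / 4 : ℝ) * L ^ (3 / 4 : ℝ) := by
    rw [hX, hE, hL]; exact (le_abs_self _).trans (hK₂ (u t) hut hdiv)
  have hEder0 := hsol.hasDerivWithinAt_half_gradNormSq hab ht'
  have hXeq : ∫ x, ⟪Torus.convect (u t) (u t) x -
      (0 : ℝ → UnitAddTorus (Fin 3) → EuclideanSpace ℝ (Fin 3)) t x, Torus.laplacian (u t) x⟫_ℝ = X := by
    rw [hX]; exact integral_congr_ae (ae_of_all _ fun x => by simp only [Pi.zero_apply, sub_zero])
  have hEder : HasDerivWithinAt (fun s => torusEnstrophy (u s)) (-ν * L + X) (Ici t) t := by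
    have h1 : HasDerivWithinAt (fun s => torusEnstrophy (u s)) (-ν * L + X) (Icc a b) t := by
      rw [hL, ← hXeq]; exact hEder0
    have hmem : Icc a b ∈ 𝓝[Ici t] t := by
      have h2 : Ici t ∩ Iio b ∈ 𝓝[Ici t] t := inter_mem_nhdsWithin _ (Iio_mem_nhds ht.2)
      exact Filter.mem_of_superset h2 fun y hy => ⟨ht.1.trans hy.1, hy.2.le⟩
    exact h1.mono_of_mem_nhdsWithin hmem
  -- the right derivative of `F_ε` (on `[t, b)` the strain moment `Z₂` is the enstrophy)
  have hΦder : HasDerivWithinAt (fun s => torusTopEigMoment 2 (u s)) RΦ (Ici t) t :=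
    hasDerivWithinAt_Ioi_iff_Ici.1 hRΦ
  have hGder : HasDerivWithinAt (fun s => torusTopEigMoment 2 (u s) + ε * torusEnstrophy (u s))
      (RΦ + ε * (-ν * L + X)) (Ici t) t := hΦder.add (hEder.const_mul ε)
  have hFder : HasDerivWithinAt (fun s => topEigStrainMix 2 ε (u s)) (RΦ + ε * (-ν * L + X))
      (Ici t) t := by
    refine hGder.congr_of_eventuallyEq ?_ ?_
    · have h2 : Ici t ∩ Iio b ∈ 𝓝[Ici t] t := inter_mem_nhdsWithin _ (Iio_mem_nhds ht.2)
      filter_upwards [h2] with s hs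
      have hsI : s ∈ Icc a b := ⟨ht.1.trans hs.1, hs.2.le⟩
      show topEigStrainMix 2 ε (u s) = torusTopEigMoment 2 (u s) + ε * torusEnstrophy (u s)
      rw [topEigStrainMix, torusStrainMoment_two (hsol.smooth_velocity.isSmooth_slice hsI)
        (hsol.divFree s hsI)]
    · show topEigStrainMix 2 ε (u t) = torusTopEigMoment 2 (u t) + ε * torusEnstrophy (u t)
      rw [topEigStrainMix, torusStrainMoment_two hut hdiv]
  refine ⟨RΦ + ε * (-ν * L + X), hFder, ?_⟩
  -- Young with the weight `εν`
  have hεν : 0 < ε * ν := mul_pos hε hν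
  have hC0 : 0 ≤ (C₁ + K₂) * (1 + ε) := mul_nonneg (add_nonneg hC₁0 hK₂0) (by linarith)
  have hstep1 : RΦ + ε * (-ν * L + X) ≤
      (C₁ + K₂) * (1 + ε) * E ^ (3 / 4 : ℝ) * L ^ (3 / 4 : ℝ) - ε * ν * L := by
    have hP0 : 0 ≤ E ^ (3 / 4 : ℝ) * L ^ (3 / 4 : ℝ) :=
      mul_nonneg (Real.rpow_nonneg hE0 _) (Real.rpow_nonneg hL0 _)
    have h1 : ε * X ≤ ε * (K₂ * E ^ (3 / 4 : ℝ) * L ^ (3 / 4 : ℝ)) := mul_le_mul_of_nonneg_left hXle hε.le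
    have h2 : C₁ * E ^ (3 / 4 : ℝ) * L ^ (3 / 4 : ℝ) + ε * (K₂ * E ^ (3 / 4 : ℝ) * L ^ (3 / 4 : ℝ)) ≤
        (C₁ + K₂) * (1 + ε) * E ^ (3 / 4 : ℝ) * L ^ (3 / 4 : ℝ) := by
      have e1 : (C₁ + K₂) * (1 + ε) * E ^ (3 / 4 : ℝ) * L ^ (3 / 4 : ℝ) =
          C₁ * E ^ (3 / 4 : ℝ) * L ^ (3 / 4 : ℝ) + ε * (K₂ * E ^ (3 / 4 : ℝ) * L ^ (3 / 4 : ℝ)) +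
          (ε * C₁ + K₂) * (E ^ (3 / 4 : ℝ) * L ^ (3 / 4 : ℝ)) := by ring
      rw [e1]
      have : 0 ≤ (ε * C₁ + K₂) * (E ^ (3 / 4 : ℝ) * L ^ (3 / 4 : ℝ)) :=
        mul_nonneg (add_nonneg (mul_nonneg hε.le hC₁0) hK₂0) hP0
      linarith
    have e2 : RΦ + ε * (-ν * L + X) = RΦ + ε * X - ε * ν * L := by ring
    rw [e2]
    linarith
  have hM0 : 0 ≤ E ^ 3 := pow_nonneg hE0 3
  have hY := VorticityMoment.young_rpow (a := 3 / 4) (by norm_num) (by norm_num) hC0 hL0 hM0 hεν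
  have hE34 : (E ^ 3) ^ ((1 : ℝ) - 3 / 4) = E ^ (3 / 4 : ℝ) := by
    rw [← Real.rpow_natCast E 3, ← Real.rpow_mul hE0]; norm_num
  rw [hE34] at hY
  have hexp1 : (1 : ℝ) / (1 - 3 / 4) = 4 := by norm_num
  have hexp2 : -((3 : ℝ) / 4 / (1 - 3 / 4)) = -3 := by norm_num
  rw [hexp1, hexp2] at hY
  have hstep2 : RΦ + ε * (-ν * L + X) ≤
      ((C₁ + K₂) * (1 + ε)) ^ (4 : ℝ) * (ε * ν) ^ (-(3 : ℝ)) * E ^ 3 := by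
    linarith
  -- THE CHANGED STEP: `E³ ≤ 5184 E F_ε²` by coercivity (`ℰ ≤ 36 F_ε`), uniformly in `ε`
  have hFε0 : 0 ≤ topEigStrainMix 2 ε (u t) := topEigStrainMix_nonneg hε.le _
  have hEle : E ≤ 72 * topEigStrainMix 2 ε (u t) := by
    have h := torusEnstrophy_le_topEigStrainMix_two hε.le hut hdiv
    rw [hEns] at h
    linarith
  have hE3 : E ^ 3 ≤ E * (5184 * topEigStrainMix 2 ε (u t) ^ 2) := by
    have h1 : E ^ 2 ≤ (72 * topEigStrainMix 2 ε (u t)) ^ 2 := pow_le_pow_left₀ hE0 hEle 2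
    calc E ^ 3 = E * E ^ 2 := by ring
      _ ≤ E * (72 * topEigStrainMix 2 ε (u t)) ^ 2 := mul_le_mul_of_nonneg_left h1 hE0
      _ = _ := by ring
  have hA0 : 0 ≤ ((C₁ + K₂) * (1 + ε)) ^ (4 : ℝ) * (ε * ν) ^ (-(3 : ℝ)) :=
    mul_nonneg (Real.rpow_nonneg hC0 _) (Real.rpow_nonneg hεν.le _)
  have hstep3 : RΦ + ε * (-ν * L + X) ≤ ((C₁ + K₂) * (1 + ε)) ^ (4 : ℝ) * (ε * ν) ^ (-(3 : ℝ)) *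
      (E * (5184 * topEigStrainMix 2 ε (u t) ^ 2)) :=
    hstep2.trans (mul_le_mul_of_nonneg_left hE3 hA0)
  have e2 : (ε * ν) ^ (-(3 : ℝ)) = ε ^ (-(3 : ℝ)) * ν ^ (-(3 : ℝ)) := Real.mul_rpow hε.le hν.le
  have e4 : 2 * torusEnstrophy (u t) = E := by rw [hEns]; ring
  rw [e4]
  calc RΦ + ε * (-ν * L + X) ≤ _ := hstep3
    _ = 5184 * ((C₁ + K₂) * (1 + ε)) ^ (4 : ℝ) * ε ^ (-(3 : ℝ)) * ν ^ (-(3 : ℝ)) *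
        (E * topEigStrainMix 2 ε (u t) ^ 2) := by rw [e2]; ring

/-! ## 3. The rate corollaries -/

/-- **K1-Q6 (a) at `q = 2` in derivative-value form, `ε^{−3}` budget.** There is `C₀ ≥ 0` such that
for every `ε > 0`, along every classical solution of unforced Navier–Stokes on `T³` (`ν > 0`), every
one-sided derivative value `R` of `s ↦ F_ε(u(s))` within the window satisfies
`R ≤ 5184 (C₀(1+ε))⁴ ε^{−3} ν^{−3} (2ℰ) F_ε²`. [ours] -/
theorem exists_topEigStrainMix_two_rate_le_gamma :
    ∃ C₀ : ℝ, 0 ≤ C₀ ∧ ∀ {ε : ℝ}, 0 < ε → ∀ {ν a b : ℝ}, 0 < ν → a < b →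
      ∀ {u : ℝ → UnitAddTorus (Fin 3) → EuclideanSpace ℝ (Fin 3)} {p : ℝ → UnitAddTorus (Fin 3) → ℝ},
      Torus.IsClassicalNSSolutionOn (Icc a b) ν 0 u p →
      ∀ t ∈ Icc a b, ∀ R : ℝ, HasDerivWithinAt (fun s => topEigStrainMix 2 ε (u s)) R (Icc a b) t →
        R ≤ 5184 * (C₀ * (1 + ε)) ^ (4 : ℝ) * ε ^ (-(3 : ℝ)) * ν ^ (-(3 : ℝ)) *
          ((2 * torusEnstrophy (u t)) * topEigStrainMix 2 ε (u t) ^ 2) := by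
  obtain ⟨C₀, hC₀, hder⟩ := exists_topEigStrainMix_two_rightDeriv_le_gamma
  refine ⟨C₀, hC₀, ?_⟩
  intro ε hε ν a b hν hab u p hsol t ht R hR
  set κ : ℝ := 5184 * (C₀ * (1 + ε)) ^ (4 : ℝ) * ε ^ (-(3 : ℝ)) * ν ^ (-(3 : ℝ)) with hκ
  set bud : ℝ → ℝ := fun s => κ * ((2 * torusEnstrophy (u s)) * topEigStrainMix 2 ε (u s) ^ 2)
    with hbud
  show R ≤ bud t
  have hcont : ContinuousWithinAt bud (Icc a b) t := by
    have hE : ContinuousWithinAt (fun s => torusEnstrophy (u s)) (Icc a b) t :=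
      (hsol.hasDerivWithinAt_half_gradNormSq hab ht).continuousWithinAt
    have hF := continuousWithinAt_topEigStrainMix_two ε hab hsol ht
    exact continuousWithinAt_const.mul ((continuousWithinAt_const.mul hE).mul (hF.pow 2))
  have hfence : ∀ ⦃t₁ t₂ : ℝ⦄, t₁ ∈ Icc a b → t₂ ∈ Icc a b → t₁ ≤ t₂ → ∀ ⦃K : ℝ⦄,
      (∀ σ ∈ Icc t₁ t₂, bud σ ≤ K) →
      topEigStrainMix 2 ε (u t₂) - topEigStrainMix 2 ε (u t₁) ≤ K * (t₂ - t₁) := by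
    intro t₁ t₂ ht₁ ht₂ hle K hK
    have hcontF : ContinuousOn (fun s => topEigStrainMix 2 ε (u s)) (Icc t₁ t₂) := fun s hs =>
      (continuousWithinAt_topEigStrainMix_two ε hab hsol
        ⟨ht₁.1.trans hs.1, hs.2.trans ht₂.2⟩).mono (Icc_subset_Icc ht₁.1 ht₂.2)
    have hD : ∀ x ∈ Ico t₁ t₂, ∃ R' : ℝ,
        HasDerivWithinAt (fun s => topEigStrainMix 2 ε (u s)) R' (Ici x) x ∧ R' ≤ K := by
      intro x hx
      have hxab : x ∈ Ico a b := ⟨ht₁.1.trans hx.1, lt_of_lt_of_le hx.2 ht₂.2⟩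
      obtain ⟨R', hR', hle'⟩ := hder hε hν hab hsol hxab
      exact ⟨R', hR', hle'.trans (hK x ⟨hx.1, hx.2.le⟩)⟩
    choose! f' hf' hf'le using hD
    exact sub_le_mul_of_deriv_right_le hle hcontF (fun x hx => hf' x hx) (fun x hx => hf'le x hx)
  exact hasDerivWithinAt_le_of_fence hab ht hcont hfence hR

/-- **The dictionary number of K1-Q6 (a) at `q = 2` is at most `3 = γ(2)`:**
`TopEigStrainMixRate 2 3` on `T³` — for `ε ∈ (0, 1]` the saturating law for `F_ε = Φ₂ + ε ℰ`
(`σ = 1`, `γ = 3`) holds with constant `C ε^{−3}`, `C = 5184 (2C₀)⁴` (`3 = (3q−3)/(2q−3)` at `q = 2`: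
the dict seat's node `TopEigStrainMixRateGamma 2`; the prove seat's staged exponent is `5`). Small-data
closing only; no regularity claim. [ours] -/
theorem topEigStrainMixRate_two_gamma : TopEigStrainMixRate (d := Fin 3) 2 3 := by
  obtain ⟨C₀, hC₀, h⟩ := exists_topEigStrainMix_two_rate_le_gamma
  refine ⟨5184 * (2 * C₀) ^ (4 : ℝ), 1, one_pos, ?_⟩
  intro ε hε hε1 _ ν hν a b hab u p hsol _ t ht R hR
  have h1 := h hε hν hab hsol t ht R hR
  have e1 : ((3 : ℝ) * 2 - 3) / (2 * 2 - 3) = 3 := by norm_num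
  have e2 : (1 : ℝ) + (2 * 2 - 3)⁻¹ = 2 := by norm_num
  rw [e1, e2, Real.rpow_two]
  have hpow : (C₀ * (1 + ε)) ^ (4 : ℝ) ≤ (2 * C₀) ^ (4 : ℝ) :=
    Real.rpow_le_rpow (mul_nonneg hC₀ (by linarith)) (by nlinarith) (by norm_num)
  have hx : 0 ≤ ε ^ (-(3 : ℝ)) * ν ^ (-(3 : ℝ)) *
      ((2 * torusEnstrophy (u t)) * topEigStrainMix 2 ε (u t) ^ 2) :=
    mul_nonneg (mul_nonneg (Real.rpow_nonneg hε.le _) (Real.rpow_nonneg hν.le _))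
      (mul_nonneg (mul_nonneg (by norm_num) (torusEnstrophy_nonneg _)) (sq_nonneg _))
  calc R ≤ 5184 * (C₀ * (1 + ε)) ^ (4 : ℝ) * (ε ^ (-(3 : ℝ)) * ν ^ (-(3 : ℝ)) *
        ((2 * torusEnstrophy (u t)) * topEigStrainMix 2 ε (u t) ^ 2)) := by
        calc R ≤ _ := h1
          _ = _ := by ring
    _ ≤ 5184 * (2 * C₀) ^ (4 : ℝ) * (ε ^ (-(3 : ℝ)) * ν ^ (-(3 : ℝ)) *
        ((2 * torusEnstrophy (u t)) * topEigStrainMix 2 ε (u t) ^ 2)) :=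
        mul_le_mul_of_nonneg_right (mul_le_mul_of_nonneg_left hpow (by norm_num)) hx
    _ = _ := by ring

/-- Every exponent `a ≥ 3` is admissible at `q = 2` — in particular the prove seat's staged
`TopEigStrainMixRate 2 5` (`TopEigStrainMixRate.mono`). [ours, bookkeeping] -/
theorem topEigStrainMixRate_two_of_three_le {a : ℝ} (ha : 3 ≤ a) :
    TopEigStrainMixRate (d := Fin 3) 2 a :=
  topEigStrainMixRate_two_gamma.mono ha

end TopEig

end Summit.NavierStokesRegularity.FunctionalMining

end
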